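/-
Copyright (c) 2026. All rights reserved.
Released under Apache 2.0 license as described in the file LICENSE.
Authors: abc-iut cell, wave-5 seat abc-iut-w5-d141 (L3 sub-DAG [SemiAnbd] Thm 5.4, row T54-5b packaging).
-/
import Literature.AnabelianGeometry.SemiGraphs.ArithQuasiGeometricGeomAdapter
import Literature.AnabelianGeometry.SemiGraphs.ArithQuasiGeometricOfIota
import HarnessLib

/-!
# [SemiAnbd] Theorem 5.4 (iii), clause 1: the umbrella's per-`φ` binders `hv` / `hb` from the datum `ι`
# (sub-DAG SemiAnbd-Thm54, row T54-5b packaging; proof-only)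

Mochizuki, *Semi-graphs of anabelioids*, Publ. RIMS **42** (2006), §5, Thm 5.4 (iii), p. 66, clause 1, with the
commensurator description of p. 65 [cite: MochizukiSemiAnbd2006, Thm 5.4 (iii), p. 66].

PROOF-ONLY composition: the per-`φ` inputs `hv` / `hb` of the Thm 5.4 (iii) umbrella
(`arithQuasiGeometricCorrespondenceStatement_of_rows` / `_of_geometric(_of_slim)`, abc-iut-w4-d085) — containment of
the arithmetic decomposition groups AND geometric openness of `B^temp(φ)` — are produced from: the datum
`ι = B^temp(−)|_{geom}` with `hιbtemp` and the ι-level Prop 3.6 (iv)/Thm 3.7 (iv) shapes `hιgeomV` / `hιgeomE`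
(`Thm54iii.geomOpenV/E_of_iota`, abc-iut-w5-d141), the commensurator description of p. 65 on both sides
(`hcommV`, `hcommV'`, `hcommB`, `hcommB'`), Rmk 5.3.1 on the `ℍ`-side (`hRH`) and continuity of `augH'`
(abc-iut-w4-d106's `hv_of_geomOpen` / `hb_of_geomOpen`).  Nothing asserted; no side on [IUTchIII] Cor 3.12.
-/

namespace Literature.AnabelianGeometry.SemiGraphs

open _root_.CategoryTheory

universe u v w uG uH uV uB uV' uB'

variable {Obj : Type u} [Category.{v} Obj] {𝓥 : SemiAnbdVocab.{u, v, w} Obj}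
variable {𝔊 ℍ : ArithSemiGraph 𝓥} {e : 𝔊.PA ≃* ℍ.PA}
variable {Gtp : Type uG} [Group Gtp] [TopologicalSpace Gtp]
variable {Htp : Type uH} [Group Htp] [TopologicalSpace Htp] [IsTopologicalGroup Htp] [T2Space Htp]
variable {V : Type uV} {B : Type uB} {V' : Type uV'} {B' : Type uB'}
variable {D : DecompositionData Gtp V B} {D' : DecompositionData Htp V' B'}

omit [TopologicalSpace Gtp] in
/-- **The umbrella's binder `hv` from the datum `ι`** (containment + geometric openness of `B^temp(φ)` on every
`Π^temp_{𝔊,v}`), from `hιbtemp`, `hιgeomV`, the commensurator description on both sides, Rmk 5.3.1 on the `ℍ`-side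
and continuity of `augH'`. [cite: MochizukiSemiAnbd2006, Thm 5.4 (iii), p. 66] -/
theorem Thm54iii.hv_of_iota (augG : Gtp →* 𝔊.PA) (augH' : Htp →* 𝔊.PA)
    (btemp : (φ : ArithHom 𝓥 𝔊 ℍ) → φ.IsLocallyOpen → ArithHom.IsOverA 𝔊 ℍ e φ → (Gtp →* Htp))
    (haugH : Continuous augH') (hRH : VerticialEdgeLikeCompactAmpleStatement D' augH')
    (hcommV : ∀ v : V, Subgroup.Commensurable.commensurator (D.vertGp v ⊓ augG.ker) = D.vertGp v)
    (hcommV' : ∀ w : V', Subgroup.Commensurable.commensurator (D'.vertGp w ⊓ augH'.ker) = D'.vertGp w)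
    (ι : (𝔊.G ⟶ ℍ.G) → (augG.ker →* Htp))
    (hιbtemp : ∀ (φ : ArithHom 𝓥 𝔊 ℍ) (h₁ : φ.IsLocallyOpen) (h₂ : ArithHom.IsOverA 𝔊 ℍ e φ),
      ∃ δ ∈ augH'.ker, ∀ x : augG.ker, btemp φ h₁ h₂ x = δ * ι φ.geom x * δ⁻¹)
    (hιgeomV : ∀ g : 𝔊.G ⟶ ℍ.G, ∃ fv : V → V', ∀ v : V, ∃ x : Htp,
      ((D.vertGp v ⊓ augG.ker).subgroupOf augG.ker).map (ι g) ≤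
          conjSubgroup x (D'.vertGp (fv v)) ⊓ augH'.ker ∧
        IsOpen ((Subtype.val : (conjSubgroup x (D'.vertGp (fv v)) ⊓ augH'.ker : Subgroup Htp) → Htp) ⁻¹'
          (((D.vertGp v ⊓ augG.ker).subgroupOf augG.ker).map (ι g) : Set Htp))) :
    ∀ (φ : ArithHom 𝓥 𝔊 ℍ) (h₁ : φ.IsLocallyOpen) (h₂ : ArithHom.IsOverA 𝔊 ℍ e φ),
      ∃ f : V → V', ∀ v : V, ∃ g : Htp,
        (D.vertGp v).map (btemp φ h₁ h₂) ≤ conjSubgroup g (D'.vertGp (f v)) ∧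
          MapsOntoOpenSubgroupOf (btemp φ h₁ h₂) (D.vertGp v ⊓ augG.ker)
            (conjSubgroup g (D'.vertGp (f v)) ⊓ augH'.ker) := by
  intro φ h₁ h₂
  obtain ⟨fv, hgeo⟩ := Thm54iii.geomOpenV_of_iota augG augH' btemp ι hιbtemp hιgeomV φ h₁ h₂
  exact ⟨fv, hv_of_geomOpen haugH hcommV hcommV' hRH fv hgeo⟩

omit [TopologicalSpace Gtp] in
/-- **The umbrella's binder `hb` from the datum `ι`** (branches), from `hιbtemp`, `hιgeomE`, the commensurator
description of the branch groups on both sides, Rmk 5.3.1 on the `ℍ`-side and continuity of `augH'`.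
[cite: MochizukiSemiAnbd2006, Thm 5.4 (iii), p. 66] -/
theorem Thm54iii.hb_of_iota (augG : Gtp →* 𝔊.PA) (augH' : Htp →* 𝔊.PA)
    (btemp : (φ : ArithHom 𝓥 𝔊 ℍ) → φ.IsLocallyOpen → ArithHom.IsOverA 𝔊 ℍ e φ → (Gtp →* Htp))
    (haugH : Continuous augH') (hRH : VerticialEdgeLikeCompactAmpleStatement D' augH')
    (hcommB : ∀ b : B, Subgroup.Commensurable.commensurator (D.brGp b ⊓ augG.ker) = D.brGp b)
    (hcommB' : ∀ b' : B', Subgroup.Commensurable.commensurator (D'.brGp b' ⊓ augH'.ker) = D'.brGp b')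
    (ι : (𝔊.G ⟶ ℍ.G) → (augG.ker →* Htp))
    (hιbtemp : ∀ (φ : ArithHom 𝓥 𝔊 ℍ) (h₁ : φ.IsLocallyOpen) (h₂ : ArithHom.IsOverA 𝔊 ℍ e φ),
      ∃ δ ∈ augH'.ker, ∀ x : augG.ker, btemp φ h₁ h₂ x = δ * ι φ.geom x * δ⁻¹)
    (hιgeomE : ∀ g : 𝔊.G ⟶ ℍ.G, ∃ fb : B → B', ∀ b : B, ∃ x : Htp,
      ((D.brGp b ⊓ augG.ker).subgroupOf augG.ker).map (ι g) ≤
          conjSubgroup x (D'.brGp (fb b)) ⊓ augH'.ker ∧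
        IsOpen ((Subtype.val : (conjSubgroup x (D'.brGp (fb b)) ⊓ augH'.ker : Subgroup Htp) → Htp) ⁻¹'
          (((D.brGp b ⊓ augG.ker).subgroupOf augG.ker).map (ι g) : Set Htp))) :
    ∀ (φ : ArithHom 𝓥 𝔊 ℍ) (h₁ : φ.IsLocallyOpen) (h₂ : ArithHom.IsOverA 𝔊 ℍ e φ),
      ∃ fb : B → B', ∀ b : B, ∃ g : Htp,
        (D.brGp b).map (btemp φ h₁ h₂) ≤ conjSubgroup g (D'.brGp (fb b)) ∧
          MapsOntoOpenSubgroupOf (btemp φ h₁ h₂) (D.brGp b ⊓ augG.ker)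
            (conjSubgroup g (D'.brGp (fb b)) ⊓ augH'.ker) := by
  intro φ h₁ h₂
  obtain ⟨fb, hgeo⟩ := Thm54iii.geomOpenE_of_iota augG augH' btemp ι hιbtemp hιgeomE φ h₁ h₂
  exact ⟨fb, hb_of_geomOpen haugH hcommB hcommB' hRH fb hgeo⟩

end Literature.AnabelianGeometry.SemiGraphs
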